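/-
Copyright: the b2b-balaban T⁴-continuum CRUX team, row NE7b OWNER lineage `t4-ne7b-p1` (gen 135). Project licence.
-/
import Summits.QuantumFields.BalabanUV.T4Continuum.Spine.NE7b.SupRegulatedActivityShift
import Literature.Probability.Distributions.GaussianLinearCompensation

/-!
# THE GRADIENT REGULATOR — THE MARGINAL CURRENCY'S THREE GAUSSIAN INPUTS: for ANY linear «difference operator» `D` (a matrix with rows indexed
# by edges `e ∈ E`) the regulator `e^{½κΣ_{e∈Y}(Dω)_e²}` of the field `ω ~ N(0,Γ)` is the FIELD regulator of the gradient field `ξ = Dω ~ N(0,DΓDᵀ)`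
# on the edge set `Y`, so (288)∕(289) BY NAME on the image Gaussian give
#   (cost)      `∫ e^{½κΣ_{e∈Y}(Dω)_e²} dN(0,Γ) ≤ A_∇^{#Y}`,  `A_∇ = (1−θ)^{−κγ_∇∕(2θ)}`,
#   (tails)     `P(t ≤ Σ_{e∈Y}(Dω)_e²) ≤ e^{−κt∕2}·A_∇^{#Y}`,
#   (activity)  `‖∫∏_{p∈K}g_p dN(0,Γ)‖ ≤ (ε·A_∇^w)^{#K}` for factors GRADIENT-REGULATED on disjoint edge sets of `≤ w` edges,
# under the subcriticality `κ·γ_op,∇ ≤ θ < 1` and the diagonal letter `γ_∇`, where NOW `DΓDᵀ ⪯ γ_op,∇·1` and `(DΓDᵀ)_{ee} ≤ γ_∇` are letters of the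
# GRADIENT covariance — for the `d = 4` shells both `γ_∇·#edges(cell)` and `γ_op,∇` are scale-invariant (`Σ_{cell}|∇ψ|²` is MARGINAL, exponent `0`),
# whereas (374) showed the field currency `Σ_{cell}ψ²` (exponent `+2`) cannot iterate: repair direction (α1) of SCOPING-d7 started (row NE7b, node U5c;
# (288)∕(289) + the tree's linear-image lemma BY NAME; [folklore])

Cell `pub-balaban`, sub-cell `t4`, spine estimate NE7b (`T4WeightBudget.RelWeightBound`; the cell's OWN estimate — NOT PRINTED in
[Bałaban 1983–89], NOT PROVED).  Crux-route work under `Spine/NE7b/` by the row OWNER (`t4-ne7b-p1` gen 135, file (375)) under FREEZE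
(0)'s crux-prover clause, on this gen's SCOPING-d7 (α1); NOTHING of Bałaban's is named as a Lean object, valued or asserted; no `T4Continuum/Support`
leaf typed; no `def`, no notation; zero `sorry`.  Imports (BY NAME): the OWNER's (292) `…SupRegulatedActivityShift` (`sum_add_sq_le`; through it (289)
`one_le_regulatorCost` and (288) `integral_exp_half_sq_on_le`, `integrable_exp_half_sq_on`, `measureReal_sum_sq_ge_le`), the tree's
`Literature/Probability/Distributions/GaussianLinearCompensation` (`multivariateGaussian_map_matrix`: `N(0,Γ)∘D⁻¹ = N(0,DΓDᵀ)`, `matrixCLM`,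
`ofLp_matrixCLM`); Mathlib's `MeasureTheory.integral_map`, `integrable_map_measure`, `Measure.map_apply`.

WHAT IS PROVED ([folklore]; `ξ := Dω`, `C := DΓDᵀ`):
* §1 THE IMAGE: `gradCov_posSemidef` (`C ⪰ 0`), **`integral_gradRegulator_eq`** (`∫F(Σ_{e∈Y}(Dω)_e²)dN(0,Γ) = ∫F(Σ_{e∈Y}ξ_e²)dN(0,C)` for the
  exponential regulator), `integrable_gradRegulator`, `measureReal_gradSq_ge_eq`;
* §2 THE THREE INPUTS IN THE GRADIENT CURRENCY: **`integral_exp_half_gradSq_on_le`** (cost), **`measureReal_gradSq_ge_le`** (tails),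
  `norm_prod_le_gradRegulator` (pointwise), **`norm_cellActivity_le_of_gradRegulated`** (activity);
* §3 the shift in the gradient currency: `gradSq_add_le` (`Σ_Y(D(ω+ψ))_e² ≤ (1+τ)Σ_Y(Dω)_e² + (1+τ⁻¹)Σ_Y(Dψ)_e²`); §4 toy.

HONEST (what this is NOT).  The Gaussian inputs only: the road's combinatorial files ((287), (296), (348)–(373)) are currency-agnostic GIVEN
these inputs but are NOT re-instantiated here; the scale-invariance of `γ_∇·#edges` and `γ_op,∇` for the lineage's `d = 4` shells needs DIFFERENCE
estimates of the single-shell kernels ((284) has entries, not differences) — successor; the two-rate bookkeeping (α2) and the smoothing regeneration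
(α3) of SCOPING-d7 are untouched (Young's `(1+τ⁻¹)` of §3 is still the naive shift); scalar skeleton ((A3), NC-NE7b-α UNRULED); nothing of
Bałaban's asserted.  BY-NAME EFFECT ON THE WALL: NONE.  NE7b NOT PRINTED ∕ NOT PROVED; spine PROVED 0∕9; rung (B)+1 — the programme's measures
remain FINITE-torus statements; NOT the mass gap, NOT Clay.  HONEST DEPENDENCY: continuum YM on T⁴ ⇐ BetaPertH ∧ nine spine estimates (0∕9
proved); BetaPertH ⇐ (D1) ∧ (D4) ∧ CAP+tail; G-an2-4 gates asym, D1 and NE2∕3∕4.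
-/

set_option autoImplicit false

noncomputable section

namespace Summit.QuantumFields.BalabanUV.T4Continuum.NE7b.SupGradientRegulator

open MeasureTheory ProbabilityTheory Matrix Real Finset
open scoped BigOperators
open Literature.Probability.LatticeModels (cellActivity)
open Literature.Probability.Distributions (multivariateGaussian_map_matrix matrixCLM ofLp_matrixCLM)
open SupRegulatedActivityBound (one_le_regulatorCost)
open SupGaussianRegulator (integral_exp_half_sq_on_le integrable_exp_half_sq_on measureReal_sum_sq_ge_le)

variable {ι E : Type} [Fintype ι] [DecidableEq ι] [Fintype E] [DecidableEq E] {V : Type*}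

/-! ## §1. The gradient field is Gaussian with covariance `DΓDᵀ` -/

omit [DecidableEq ι] [DecidableEq E] in
/-- `DΓDᵀ ⪰ 0` for `Γ ⪰ 0`. [folklore] -/
theorem gradCov_posSemidef {Γ : Matrix ι ι ℝ} (hΓ : Γ.PosSemidef) (D : Matrix E ι ℝ) : (D * Γ * Dᵀ).PosSemidef := by
  simpa [conjTranspose_eq_transpose_of_trivial] using hΓ.mul_mul_conjTranspose_same D

/-- **THE GRADIENT REGULATOR IS THE FIELD REGULATOR OF THE IMAGE GAUSSIAN**: for `Γ ⪰ 0`, any `D`, `Y`, `κ`,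
`∫ e^{½κΣ_{e∈Y}(Dω)_e²} dN(0,Γ)(ω) = ∫ e^{½κΣ_{e∈Y}ξ_e²} dN(0,DΓDᵀ)(ξ)`. [folklore] -/
theorem integral_gradRegulator_eq {Γ : Matrix ι ι ℝ} (hΓ : Γ.PosSemidef) (D : Matrix E ι ℝ) (Y : Finset E) (κ : ℝ) :
    ∫ ω, exp (κ * (∑ e ∈ Y, (D *ᵥ WithLp.ofLp ω) e ^ 2) / 2) ∂(multivariateGaussian (0 : EuclideanSpace ℝ ι) Γ) =
      ∫ ξ, exp (κ * (∑ e ∈ Y, ξ e ^ 2) / 2) ∂(multivariateGaussian (0 : EuclideanSpace ℝ E) (D * Γ * Dᵀ)) := by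
  rw [← multivariateGaussian_map_matrix hΓ D, integral_map (matrixCLM D).continuous.measurable.aemeasurable]
  · rfl
  · exact (Measurable.aestronglyMeasurable (by fun_prop))

/-- The gradient regulator is integrable under `κγ_op,∇ ≤ θ < 1`, `0 ≤ κ`, `DΓDᵀ ⪯ γ_op,∇·1`. [folklore] -/
theorem integrable_gradRegulator {Γ : Matrix ι ι ℝ} {γop κ θ : ℝ} (hΓ : Γ.PosSemidef) (D : Matrix E ι ℝ)
    (hC : (γop • (1 : Matrix E E ℝ) - D * Γ * Dᵀ).PosSemidef) (hκ : 0 ≤ κ) (hθ1 : θ < 1) (hκθ : κ * γop ≤ θ) (Y : Finset E) :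
    Integrable (fun ω : EuclideanSpace ℝ ι => exp (κ * (∑ e ∈ Y, (D *ᵥ WithLp.ofLp ω) e ^ 2) / 2)) (multivariateGaussian 0 Γ) := by
  have h := integrable_exp_half_sq_on (gradCov_posSemidef hΓ D) hC hκ hθ1 hκθ Y
  rw [← multivariateGaussian_map_matrix hΓ D, integrable_map_measure (Measurable.aestronglyMeasurable (by fun_prop))
    (matrixCLM D).continuous.measurable.aemeasurable] at h
  exact h

/-- The large-gradient event has the same probability under the field law and under the image law. [folklore] -/
theorem measureReal_gradSq_ge_eq {Γ : Matrix ι ι ℝ} (hΓ : Γ.PosSemidef) (D : Matrix E ι ℝ) (Y : Finset E) (t : ℝ) :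
    (multivariateGaussian (0 : EuclideanSpace ℝ ι) Γ).real {ω | t ≤ ∑ e ∈ Y, (D *ᵥ WithLp.ofLp ω) e ^ 2} =
      (multivariateGaussian (0 : EuclideanSpace ℝ E) (D * Γ * Dᵀ)).real {ξ | t ≤ ∑ e ∈ Y, ξ e ^ 2} := by
  have hmeas : MeasurableSet {ξ : EuclideanSpace ℝ E | t ≤ ∑ e ∈ Y, ξ e ^ 2} := measurableSet_le measurable_const (by fun_prop)
  rw [← multivariateGaussian_map_matrix hΓ D, measureReal_def, measureReal_def,
    Measure.map_apply (matrixCLM D).continuous.measurable hmeas]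
  rfl

/-! ## §2. The three Gaussian inputs in the gradient currency -/

/-- **(cost) THE GRADIENT REGULATOR ON `Y` COSTS `A_∇^{#Y}`**: `Γ ⪰ 0`, `DΓDᵀ ⪯ γ_op,∇·1`, `(DΓDᵀ)_{ee} ≤ γ_∇` on `Y`, `0 ≤ κ`, `0 < θ < 1`,
`κγ_op,∇ ≤ θ` ⟹ `∫ e^{½κΣ_{e∈Y}(Dω)_e²} dN(0,Γ) ≤ ((1−θ)^{−κγ_∇∕(2θ)})^{#Y}`. [folklore] -/
theorem integral_exp_half_gradSq_on_le {Γ : Matrix ι ι ℝ} {γop γ κ θ : ℝ} (hΓ : Γ.PosSemidef) (D : Matrix E ι ℝ)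
    (hC : (γop • (1 : Matrix E E ℝ) - D * Γ * Dᵀ).PosSemidef) (hκ : 0 ≤ κ) (hθ0 : 0 < θ) (hθ1 : θ < 1) (hκθ : κ * γop ≤ θ)
    (Y : Finset E) (hdiag : ∀ e ∈ Y, (D * Γ * Dᵀ) e e ≤ γ) :
    ∫ ω, exp (κ * (∑ e ∈ Y, (D *ᵥ WithLp.ofLp ω) e ^ 2) / 2) ∂(multivariateGaussian (0 : EuclideanSpace ℝ ι) Γ) ≤
      ((1 - θ) ^ (-(κ * γ / (2 * θ)))) ^ Y.card := by
  rw [integral_gradRegulator_eq hΓ D Y κ]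
  exact integral_exp_half_sq_on_le (gradCov_posSemidef hΓ D) hC hκ hθ0 hθ1 hκθ Y hdiag

/-- **(tails) LARGE GRADIENTS ARE RARE, MULTIPLICATIVELY IN `#Y`**: under the same hypotheses, for every `t`,
`P_{N(0,Γ)}(t ≤ Σ_{e∈Y}(Dω)_e²) ≤ e^{−κt∕2}·((1−θ)^{−κγ_∇∕(2θ)})^{#Y}`. [folklore] -/
theorem measureReal_gradSq_ge_le {Γ : Matrix ι ι ℝ} {γop γ κ θ : ℝ} (hΓ : Γ.PosSemidef) (D : Matrix E ι ℝ)
    (hC : (γop • (1 : Matrix E E ℝ) - D * Γ * Dᵀ).PosSemidef) (hκ : 0 ≤ κ) (hθ0 : 0 < θ) (hθ1 : θ < 1) (hκθ : κ * γop ≤ θ)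
    (Y : Finset E) (hdiag : ∀ e ∈ Y, (D * Γ * Dᵀ) e e ≤ γ) (t : ℝ) :
    (multivariateGaussian (0 : EuclideanSpace ℝ ι) Γ).real {ω | t ≤ ∑ e ∈ Y, (D *ᵥ WithLp.ofLp ω) e ^ 2} ≤
      exp (-(κ * t / 2)) * ((1 - θ) ^ (-(κ * γ / (2 * θ)))) ^ Y.card := by
  rw [measureReal_gradSq_ge_eq hΓ D Y t]
  exact measureReal_sum_sq_ge_le (gradCov_posSemidef hΓ D) hC hκ hθ0 hθ1 hκθ Y hdiag t

omit [DecidableEq ι] [Fintype E] in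
/-- **(pointwise) PRODUCTS OF GRADIENT-REGULATED FACTORS**: pairwise disjoint edge sets `edges p`, `‖g_p(ω)‖ ≤ ε·e^{½κΣ_{e∈edges p}(Dω)_e²}`
⟹ `‖∏_{p∈K}g_p(ω)‖ ≤ ε^{#K}·e^{½κΣ_{e∈⋃_{p∈K}edges p}(Dω)_e²}`. [folklore] -/
theorem norm_prod_le_gradRegulator [DecidableEq V] (edges : V → Finset E) (hdisj : ∀ p q, p ≠ q → Disjoint (edges p) (edges q))
    (D : Matrix E ι ℝ) {g : V → EuclideanSpace ℝ ι → ℂ} {ε κ : ℝ}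
    (hreg : ∀ p ω, ‖g p ω‖ ≤ ε * exp (κ * (∑ e ∈ edges p, (D *ᵥ WithLp.ofLp ω) e ^ 2) / 2)) (K : Finset V) (ω : EuclideanSpace ℝ ι) :
    ‖∏ p ∈ K, g p ω‖ ≤ ε ^ K.card * exp (κ * (∑ e ∈ K.biUnion edges, (D *ᵥ WithLp.ofLp ω) e ^ 2) / 2) := by
  have hpd : (K : Set V).PairwiseDisjoint edges := fun p _ q _ hpq => hdisj p q hpq
  rw [norm_prod]
  calc ∏ p ∈ K, ‖g p ω‖ ≤ ∏ p ∈ K, (ε * exp (κ * (∑ e ∈ edges p, (D *ᵥ WithLp.ofLp ω) e ^ 2) / 2)) :=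
        prod_le_prod (fun p _ => norm_nonneg _) fun p _ => hreg p ω
    _ = ε ^ K.card * exp (κ * (∑ e ∈ K.biUnion edges, (D *ᵥ WithLp.ofLp ω) e ^ 2) / 2) := by
        rw [prod_mul_distrib, prod_const, ← Real.exp_sum, sum_biUnion hpd, mul_sum, sum_div]

/-- **(activity) THE ACTIVITY BOUND FOR GRADIENT-REGULATED FACTORS.**  `Γ ⪰ 0`; `DΓDᵀ ⪯ γ_op,∇·1` with diagonal `≤ γ_∇` (`γ_∇ ≥ 0`); pairwise
disjoint edge sets of `≤ w` edges; factors Borel-measurable with `‖g_p(ω)‖ ≤ ε·e^{½κΣ_{e∈edges p}(Dω)_e²}` (`0 ≤ ε`, `0 ≤ κ`, `0 < θ < 1`,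
`κγ_op,∇ ≤ θ`) ⟹ for every finite `K`: `‖∫∏_{p∈K}g_p dN(0,Γ)‖ ≤ (ε·A_∇^w)^{#K}`, `A_∇ = (1−θ)^{−κγ_∇∕(2θ)}`. [folklore] -/
theorem norm_cellActivity_le_of_gradRegulated [DecidableEq V] {Γ : Matrix ι ι ℝ} {γop γ : ℝ} (hΓ : Γ.PosSemidef) (D : Matrix E ι ℝ)
    (hC : (γop • (1 : Matrix E E ℝ) - D * Γ * Dᵀ).PosSemidef) (hdiag : ∀ e, (D * Γ * Dᵀ) e e ≤ γ) (hγ : 0 ≤ γ)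
    (edges : V → Finset E) (hdisj : ∀ p q, p ≠ q → Disjoint (edges p) (edges q)) {w : ℕ} (hw : ∀ p, (edges p).card ≤ w)
    {g : V → EuclideanSpace ℝ ι → ℂ} {ε κ θ : ℝ} (hε : 0 ≤ ε) (hκ : 0 ≤ κ) (hθ0 : 0 < θ) (hθ1 : θ < 1) (hκθ : κ * γop ≤ θ)
    (hreg : ∀ p ω, ‖g p ω‖ ≤ ε * exp (κ * (∑ e ∈ edges p, (D *ᵥ WithLp.ofLp ω) e ^ 2) / 2)) (K : Finset V) :
    ‖cellActivity (multivariateGaussian (0 : EuclideanSpace ℝ ι) Γ) g K‖ ≤ (ε * ((1 - θ) ^ (-(κ * γ / (2 * θ)))) ^ w) ^ K.card := by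
  set μ := multivariateGaussian (0 : EuclideanSpace ℝ ι) Γ with hμ
  set A : ℝ := (1 - θ) ^ (-(κ * γ / (2 * θ))) with hA
  set U := K.biUnion edges with hU
  have hA1 : 1 ≤ A := one_le_regulatorCost (mul_nonneg hκ hγ) hθ0 hθ1
  have hint := integrable_gradRegulator hΓ D hC hκ hθ1 hκθ U
  have hgauss := integral_exp_half_gradSq_on_le hΓ D hC hκ hθ0 hθ1 hκθ U fun e _ => hdiag e
  have hUw : U.card ≤ w * K.card := by
    calc U.card ≤ ∑ p ∈ K, (edges p).card := card_biUnion_le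
      _ ≤ K.card • w := sum_le_card_nsmul _ _ _ fun p _ => hw p
      _ = w * K.card := by rw [smul_eq_mul, mul_comm]
  unfold cellActivity
  calc ‖∫ ω, ∏ p ∈ K, g p ω ∂μ‖ ≤ ∫ ω, ‖∏ p ∈ K, g p ω‖ ∂μ := norm_integral_le_integral_norm _
    _ ≤ ∫ ω, ε ^ K.card * exp (κ * (∑ e ∈ U, (D *ᵥ WithLp.ofLp ω) e ^ 2) / 2) ∂μ :=
        integral_mono_of_nonneg (ae_of_all _ fun _ => norm_nonneg _) (hint.const_mul _)
          (ae_of_all _ fun ω => norm_prod_le_gradRegulator edges hdisj D hreg K ω)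
    _ = ε ^ K.card * ∫ ω, exp (κ * (∑ e ∈ U, (D *ᵥ WithLp.ofLp ω) e ^ 2) / 2) ∂μ := integral_const_mul _ _
    _ ≤ ε ^ K.card * A ^ U.card := mul_le_mul_of_nonneg_left hgauss (pow_nonneg hε _)
    _ ≤ ε ^ K.card * A ^ (w * K.card) := mul_le_mul_of_nonneg_left (pow_le_pow_right₀ hA1 hUw) (pow_nonneg hε _)
    _ = (ε * A ^ w) ^ K.card := by rw [mul_pow, ← pow_mul]

/-! ## §3. The shift in the gradient currency -/

omit [DecidableEq ι] [Fintype E] [DecidableEq E] in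
/-- **YOUNG FOR GRADIENTS** (`D` linear): `Σ_{e∈Y}(D(ω+ψ))_e² ≤ (1+τ)Σ_{e∈Y}(Dω)_e² + (1+τ⁻¹)Σ_{e∈Y}(Dψ)_e²` for `τ > 0`. [folklore] -/
theorem gradSq_add_le (D : Matrix E ι ℝ) (Y : Finset E) (ω ψ : EuclideanSpace ℝ ι) {τ : ℝ} (hτ : 0 < τ) :
    ∑ e ∈ Y, (D *ᵥ WithLp.ofLp (ω + ψ)) e ^ 2 ≤
      (1 + τ) * ∑ e ∈ Y, (D *ᵥ WithLp.ofLp ω) e ^ 2 + (1 + τ⁻¹) * ∑ e ∈ Y, (D *ᵥ WithLp.ofLp ψ) e ^ 2 := by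
  have hlin : ∀ e, (D *ᵥ WithLp.ofLp (ω + ψ)) e = (D *ᵥ WithLp.ofLp ω) e + (D *ᵥ WithLp.ofLp ψ) e := fun e => by
    rw [WithLp.ofLp_add, mulVec_add, Pi.add_apply]
  simp only [hlin]
  exact SupRegulatedActivityShift.sum_add_sq_le Y (fun e => (D *ᵥ WithLp.ofLp ω) e) (fun e => (D *ᵥ WithLp.ofLp ψ) e) hτ

/-! ## §4. Toy -/

omit [DecidableEq ι] [DecidableEq E] in
/-- Toy (§1): the ZERO difference operator has the zero gradient covariance `0·Γ·0ᵀ = 0 ⪰ 0`. -/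
example {Γ : Matrix ι ι ℝ} (hΓ : Γ.PosSemidef) : ((0 : Matrix E ι ℝ) * Γ * (0 : Matrix E ι ℝ)ᵀ).PosSemidef :=
  gradCov_posSemidef hΓ 0

end Summit.QuantumFields.BalabanUV.T4Continuum.NE7b.SupGradientRegulator
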